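import Summits.Langlands.Langlands.Theorems.SqrtFiveQuarticCoversBoxBorelFiveLevelThreeHauptmoduls
import Summits.Langlands.Langlands.Theorems.SqrtFiveQuarticCoversBorelFiveX0FiveHauptmodul

/-!
# Route `SqrtFiveQuarticCovers`, crux `BoxBorelFive` (stmt-Langlands-17835): the level-`3` and
# level-`5` hypotheses of the crux as a `K`-point of `X(b3,b5) = X₀(15)` or `X(s3,b5)` over `j(E)`

Assembly of the landed bricks p799099 (`X₀(3)`), p800188 (`X_s⁺(3)`), p800867 (`X₀(5)`): under the
hypotheses `h3` (`b3 ∨ s3` framing of `E[3]`) and `h5` (`b5` framing of `E[5]`) of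
`Summit.Langlands.Langlands.Theses.SqrtFiveQuarticCovers.BoxBorelFive` VERBATIM, the curve `E ⊗ K`
(`Δ ≠ 0`) carries SIMULTANEOUSLY a `K`-point of `X₀(5)` over `j(E)` — `∃ h, c₄³h = (h²+10h+5)³Δ` — and
level-`3` data — a `K`-point of `X₀(3)` (`∃ t ≠ 0, c₄³t = (t+27)(t+3)³Δ`), or `j ∈ {0, 1728}`, or a
`K`-point of `X_s⁺(3)` (`∃ u, c₄³u³ = 27(u+1)³(u−3)³Δ`).  In Box's language (Box 2022, §1.1, p. 5):
`E` gives a `K`-point of `X(b3,b5) = X₀(15)` or of `X(s3,b5)`, the level-`15` part of the four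
`b5`-curves of Thm. 1.5 — here in hauptmodul coordinates, kernel-checked, with NO moduli theory assumed.

Proved, no named fact.  HONEST STATUS: helper of stmt-Langlands-17835; the crux stays conditional on
`Box2022_theorem1_5_modular` (the quartic-points theorem on those curves + Thm. 1.4); nothing here proves
modularity of any curve.

References: [Box2022] §1.1, Thm. 1.5; [FreitasLeHungSiksek2015] §2.2; J. H. Silverman, GTM 106, III.§7.
-/

noncomputable section

set_option linter.dupNamespace false -- project-wide option (lakefile weak.linter.dupNamespace); `Summit.Langlands.Langlands` is the mandated namespace

open scoped Classical
open scoped Matrix NumberField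

namespace Summit.Langlands.Langlands.Theorems.SqrtFiveQuarticCovers

open WeierstrassCurve Literature.NumberTheory.GaloisRepresentations Polynomial

/-- **`BoxBorelFive`'s level-`3` and level-`5` binders as modular-curve data.**  For a number field
`K`, `E / 𝓞 K` with `Δ(E) ≠ 0`, a framing of `E[3]` that is Borel or lands in `C_s⁺(3)` (`h3`), and a
Borel framing of `E[5]` (`h5`) — both VERBATIM from `BoxBorelFive` —: `E ⊗ K` has a `K`-point of
`X₀(5)` over `j(E)` AND (`X₀(3)`-point, or `j ∈ {0,1728}`, or `X_s⁺(3)`-point), all in hauptmodul form.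
Proof: `exists_X0_five_hauptmodul_of_borelFive_framing` (p800867) and
`levelThree_hauptmoduls_of_framing` (p800248). [cite: Box2022, §1.1, Thm. 1.5] -/
theorem levelFifteen_hauptmoduls_of_framings (K : Type) [Field K] [NumberField K]
    (E : WeierstrassCurve (𝓞 K)) (hE : E.Δ ≠ 0)
    (h3 : ∃ ρ : Literature.NumberTheory.GaloisRepresentations.FramedGaloisRep K (ZMod 3) 2,
      (∃ e : (E.baseChange K).geomTorsion ((3 : ℕ) : ℤ) ≃+ (Fin 2 → ZMod 3),
        ∀ (σ : Field.absoluteGaloisGroup K) (P : (E.baseChange K).geomTorsion ((3 : ℕ) : ℤ)),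
          e (σ • P) = ((ρ σ : GL (Fin 2) (ZMod 3)) : Matrix (Fin 2) (Fin 2) (ZMod 3)) *ᵥ (e P)) ∧
      ((∀ σ : Field.absoluteGaloisGroup K,
          (((ρ σ : GL (Fin 2) (ZMod 3)) : Matrix (Fin 2) (Fin 2) (ZMod 3)) 1 0 = 0)) ∨
        (∀ σ : Field.absoluteGaloisGroup K, (ρ σ : GL (Fin 2) (ZMod 3)) ∈ Subgroup.closure
          ({(⟨!![1, 0; 0, 2], !![1, 0; 0, 2], by decide, by decide⟩ : GL (Fin 2) (ZMod 3)),
            (⟨!![0, 1; 1, 0], !![0, 1; 1, 0], by decide, by decide⟩ : GL (Fin 2) (ZMod 3))} :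
            Set (GL (Fin 2) (ZMod 3))))))
    (h5 : ∃ ρ : Literature.NumberTheory.GaloisRepresentations.FramedGaloisRep K (ZMod 5) 2,
      (∃ e : (E.baseChange K).geomTorsion ((5 : ℕ) : ℤ) ≃+ (Fin 2 → ZMod 5),
        ∀ (σ : Field.absoluteGaloisGroup K) (P : (E.baseChange K).geomTorsion ((5 : ℕ) : ℤ)),
          e (σ • P) = ((ρ σ : GL (Fin 2) (ZMod 5)) : Matrix (Fin 2) (Fin 2) (ZMod 5)) *ᵥ (e P)) ∧
      (∀ σ : Field.absoluteGaloisGroup K,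
        (((ρ σ : GL (Fin 2) (ZMod 5)) : Matrix (Fin 2) (Fin 2) (ZMod 5)) 1 0 = 0))) :
    (∃ h : K, (E.baseChange K).c₄ ^ 3 * h = (h ^ 2 + 10 * h + 5) ^ 3 * (E.baseChange K).Δ) ∧
    ((∃ t : K, t ≠ 0 ∧ (E.baseChange K).c₄ ^ 3 * t = (t + 27) * (t + 3) ^ 3 * (E.baseChange K).Δ) ∨
      (E.baseChange K).c₄ = 0 ∨ (E.baseChange K).c₄ ^ 3 = 1728 * (E.baseChange K).Δ ∨
      (∃ u : K, (E.baseChange K).c₄ ^ 3 * u ^ 3 = 27 * (u + 1) ^ 3 * (u - 3) ^ 3 * (E.baseChange K).Δ)) :=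
  ⟨exists_X0_five_hauptmodul_of_borelFive_framing K E h5, levelThree_hauptmoduls_of_framing K E hE h3⟩

end Summit.Langlands.Langlands.Theorems.SqrtFiveQuarticCovers

end
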